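import Literature.AnabelianGeometry.Anabelioids.BCatFullSubcategoryIdRigid
import HarnessLib

/-!
# Twisted natural families on `B(G)` come from inner automorphisms: `θ^* ≅ 𝟭` forces `θ = Inn`

Topic `Literature/AnabelianGeometry/Anabelioids`, sequel of `BCatFullSubcategoryIdRigid.lean`
(abc-iut cell, campaign-L R1, the per-object criterion of [AbsTopIII] Prop. 4.2 (i)).  For a
profinite group `G`, an ENDOMORPHISM `θ : G →* G` and a full subcategory `P` of `B(G)` containing
the coset objects `G ⧸ K` (`K` open normal), call a family of maps `η_U : U → U` (`U ∈ P`)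
*`θ`-twisted natural* if `η_U (θ g • x) = g • η_U x` and `η_V ∘ k = k ∘ η_U` for all morphisms
`k : U ⟶ V` of `P` (i.e. `η` is a natural transformation from the `θ`-twisted forgetful action to
the identity; for `θ = id` these are the endomorphisms of `𝟭_P`).  [SemiAnbd] §0's compactness
argument (the tree's `isIdRigid_fullSubcategory_bCat_of_center_eq_bot`, the case `θ = id`) gives:

* `exists_eq_conj_of_twisted_natural` — **a `θ`-twisted natural family exists only if `θ` is INNER**:
  there is `n ∈ G` with `θ g = n⁻¹ g n` for all `g` (the base cosets `η(eK) = n_K K` form a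
  compatible family of closed cosets, `n ∈ ⋂ n_K K` by compactness, and naturality along the right
  translations of `G/K` gives `θ(g) ≡ n_K⁻¹ g n_K (mod K)`);
* `forall_mem_center_of_natural_family` — the untwisted case: the elements `n` so obtained for an
  endomorphism family of `𝟭_P` are central (so `Z(G) = 1` forces `η(eK) = eK`, as in the parent file).

Use (the honest per-object criterion replacing «(H1)» of the cell's
`HolRS.isIdRigid_mapsTo_of_over`): an automorphism `a` of an object `𝕏` extends to an automorphism of
the identity functor of «objects over `𝕏`» only if the pull-back along `a` is isomorphic to the
identity of `Cov^fin(𝕏) ≌ B(π̂₁)`, i.e. only if `a_*` is INNER on `π̂₁(𝕏^top)`; for hyperbolic `𝕏`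
non-trivial automorphisms act non-trivially on `π̂₁^{ab}` and are therefore excluded — the content of
[AbsTopIII] Lemma 4.3 at the object, without the over-strong hypothesis `Z(Aut 𝕏) = 1`.

Everything is proved; no definitions, no instances, no named facts.  Nothing here bears on
[IUTchIII] Cor. 3.12.

## References

* S. Mochizuki, *Semi-graphs of anabelioids*, Publ. RIMS 42 (2006), §0 p. 6. [MochizukiSemiAnbd2006]
* S. Mochizuki, *Topics in Absolute Anabelian Geometry III*, §0 p. 27, Prop. 4.2 (i) / Lemma 4.3
  p. 106. [MochizukiAbsTopIII2015]
-/

noncomputable section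

namespace Literature.AnabelianGeometry.Anabelioids

open _root_.CategoryTheory
open Literature.AlgebraicGeometry.Frobenioids (BCat)
open scoped FintypeCatDiscrete Pointwise

universe u

variable {G : Type u} [Group G] [TopologicalSpace G] [IsTopologicalGroup G]
  [CompactSpace G] [TotallyDisconnectedSpace G]

/-- **A `θ`-twisted natural family on a full subcategory of `B(G)` containing the coset objects forces
`θ` to be inner** (profinite `G`, `θ : G →* G` any endomorphism): if maps `η_U : U → U`, `U ∈ P`,
satisfy `η_U (θ g • x) = g • η_U x` and commute with every morphism of `P`, then `θ g = n⁻¹ g n` for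
some `n ∈ G` and all `g`.  (Compactness argument of [SemiAnbd] §0 as in the tree's
`isIdRigid_fullSubcategory_bCat_of_center_eq_bot`, with the right translations of the coset objects
`G ⧸ K` now recording `θ` modulo `K`.) [cite: MochizukiSemiAnbd2006, Section 0 p.6]
[cite: MochizukiAbsTopIII2015, Section 0 p.27] -/
theorem exists_eq_conj_of_twisted_natural (θ : G →* G) (P : ObjectProperty (BCat G))
    (hP : ∀ (K : OpenNormalSubgroup G) [Finite (G ⧸ K.toSubgroup)],
      P (Induction.quotObj K.toSubgroup K.isOpen'))
    (η : ∀ U : P.FullSubcategory, U.obj.obj.V → U.obj.obj.V)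
    (hηeq : ∀ (U : P.FullSubcategory) (g : G) (x : U.obj.obj.V), η U (θ g • x) = g • η U x)
    (hηnat : ∀ {U V : P.FullSubcategory} (k : U ⟶ V) (x : U.obj.obj.V),
      η V (k.hom.hom.hom x) = k.hom.hom.hom (η U x)) :
    ∃ n : G, ∀ g : G, θ g = n⁻¹ * g * n := by
  classical
  haveI hfin : ∀ K : OpenNormalSubgroup G, Finite (G ⧸ K.toSubgroup) :=
    fun K => Subgroup.quotient_finite_of_isOpen K.toSubgroup K.isOpen'
  -- the coset objects `G/K`, inside the subcategory
  let QV : OpenNormalSubgroup G → P.FullSubcategory := fun K =>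
    ⟨Induction.quotObj K.toSubgroup K.isOpen', hP K⟩
  -- `η` on the cosets
  let ev : ∀ K : OpenNormalSubgroup G, G ⧸ K.toSubgroup → G ⧸ K.toSubgroup := fun K q => η (QV K) q
  have ev_smul : ∀ K (g : G) (q : G ⧸ K.toSubgroup), ev K (θ g • q) = g • ev K q :=
    fun K g q => hηeq (QV K) g q
  -- (1) monotonicity: naturality along the projection `G/K' → G/K`
  have mono : ∀ (K K' : OpenNormalSubgroup G) (hle : K'.toSubgroup ≤ K.toSubgroup) (n : G),
      ev K' ((1 : G) : G ⧸ K'.toSubgroup) = (n : G ⧸ K'.toSubgroup) →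
      ev K ((1 : G) : G ⧸ K.toSubgroup) = (n : G ⧸ K.toSubgroup) := by
    intro K K' hle n hn
    let p : QV K' ⟶ QV K := ObjectProperty.homMk (ObjectProperty.homMk
      { hom := FintypeCat.homMk fun q : G ⧸ K'.toSubgroup =>
          Quotient.map' id (fun g g' h => by
            have h' : g⁻¹ * g' ∈ K'.toSubgroup := QuotientGroup.leftRel_apply.mp h
            exact QuotientGroup.leftRel_apply.mpr (hle h')) q
        comm := fun x => by
          apply FintypeCat.hom_ext
          intro q
          obtain ⟨g, rfl⟩ := QuotientGroup.mk_surjective (q : G ⧸ K'.toSubgroup)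
          simp only [FintypeCat.comp_apply, FintypeCat.homMk_apply]
          change Quotient.map' id _ (x • (g : G ⧸ K'.toSubgroup)) =
            (x • (g : G ⧸ K.toSubgroup) : G ⧸ K.toSubgroup)
          rw [MulAction.Quotient.smul_coe, smul_eq_mul, MulAction.Quotient.smul_coe, smul_eq_mul]
          rfl })
    have h := hηnat p ((1 : G) : G ⧸ K'.toSubgroup)
    have hn₁ : η (QV K') ((1 : G) : G ⧸ K'.toSubgroup) = (n : G ⧸ K'.toSubgroup) := hn
    rw [hn₁] at h
    exact h
  -- (2) naturality along right multiplication by an arbitrary `x ∈ G` (`K` is normal)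
  have conj : ∀ (K : OpenNormalSubgroup G) (x : G) (n : G),
      ev K ((1 : G) : G ⧸ K.toSubgroup) = (n : G ⧸ K.toSubgroup) →
      ev K (x : G ⧸ K.toSubgroup) = ((n * x : G) : G ⧸ K.toSubgroup) := by
    intro K x n hn
    let r : QV K ⟶ QV K := ObjectProperty.homMk (ObjectProperty.homMk
      { hom := FintypeCat.homMk fun q : G ⧸ K.toSubgroup =>
          Quotient.map' (fun g : G => g * x) (fun g g' h => by
            have h' : g⁻¹ * g' ∈ K.toSubgroup := QuotientGroup.leftRel_apply.mp h
            apply QuotientGroup.leftRel_apply.mpr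
            have : (g * x)⁻¹ * (g' * x) = x⁻¹ * (g⁻¹ * g') * x := by group
            rw [this]
            exact K.isNormal'.conj_mem' _ h' x) q
        comm := fun y => by
          apply FintypeCat.hom_ext
          intro q
          obtain ⟨g, rfl⟩ := QuotientGroup.mk_surjective (q : G ⧸ K.toSubgroup)
          simp only [FintypeCat.comp_apply, FintypeCat.homMk_apply]
          change Quotient.map' _ _ (y • (g : G ⧸ K.toSubgroup)) =
            (y • ((g * x : G) : G ⧸ K.toSubgroup) : G ⧸ K.toSubgroup)
          rw [MulAction.Quotient.smul_coe, smul_eq_mul, MulAction.Quotient.smul_coe, smul_eq_mul]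
          change (((y * g) * x : G) : G ⧸ K.toSubgroup) = ((y * (g * x) : G) : G ⧸ K.toSubgroup)
          rw [mul_assoc] })
    have h := hηnat r ((1 : G) : G ⧸ K.toSubgroup)
    have hn₁ : η (QV K) ((1 : G) : G ⧸ K.toSubgroup) = (n : G ⧸ K.toSubgroup) := hn
    rw [hn₁] at h
    have h' : ev K (((1 : G) * x : G) : G ⧸ K.toSubgroup) = ((n * x : G) : G ⧸ K.toSubgroup) := h
    rw [one_mul] at h'
    exact h'
  -- (3) compactness: an element `n` in all the closed cosets `n_K K`
  obtain ⟨K₀, -⟩ := ProfiniteGrp.exist_openNormalSubgroup_sub_open_nhds_of_one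
    (isOpen_univ (X := G)) (Set.mem_univ (1 : G))
  haveI : Nonempty (OpenNormalSubgroup G) := ⟨K₀⟩
  let N : OpenNormalSubgroup G → Set G := fun K =>
    {n : G | ev K ((1 : G) : G ⧸ K.toSubgroup) = (n : G ⧸ K.toSubgroup)}
  have hNne : ∀ K, (N K).Nonempty := fun K => by
    obtain ⟨n, hn⟩ := QuotientGroup.mk_surjective (ev K ((1 : G) : G ⧸ K.toSubgroup))
    exact ⟨n, hn.symm⟩
  have hNclosed : ∀ K, IsClosed (N K) := fun K => by
    obtain ⟨n₀, hn₀⟩ := hNne K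
    have : N K = (fun n : G => n₀⁻¹ * n) ⁻¹' (K : Set G) := by
      ext n
      simp only [Set.mem_setOf_eq, Set.mem_preimage, N, SetLike.mem_coe]
      rw [hn₀, QuotientGroup.eq]
      rfl
    rw [this]
    exact K.toOpenSubgroup.isClosed.preimage (by fun_prop)
  have hinf : ∀ (K K' : OpenNormalSubgroup G) (g : G), g ∈ (K ⊓ K').toSubgroup →
      g ∈ K.toSubgroup ∧ g ∈ K'.toSubgroup := fun K K' g hg => Subgroup.mem_inf.mp hg
  have hdir : Directed (· ⊇ ·) N := fun K K' => by
    refine ⟨K ⊓ K', ?_, ?_⟩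
    · intro n hn
      exact mono K (K ⊓ K') (fun g hg => (hinf _ _ g hg).1) n hn
    · intro n hn
      exact mono K' (K ⊓ K') (fun g hg => (hinf _ _ g hg).2) n hn
  obtain ⟨n, hn⟩ := IsCompact.nonempty_iInter_of_directed_nonempty_isCompact_isClosed N hdir
    hNne (fun K => (hNclosed K).isCompact) hNclosed
  have hn' : ∀ K : OpenNormalSubgroup G, n ∈ N K := fun K => Set.mem_iInter.mp hn K
  -- (4) `θ g ≡ n⁻¹ g n` modulo every `K`, hence on the nose
  refine ⟨n, fun g => ?_⟩
  have hmem : ∀ K : OpenNormalSubgroup G, (n⁻¹ * g * n)⁻¹ * θ g ∈ K.toSubgroup := fun K => by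
    -- `η(θ g • eK) = g n_K K` (twisted equivariance) and `= n_K θ(g) K` (right translation)
    have h1 : ev K ((θ g : G) : G ⧸ K.toSubgroup) = ((n * θ g : G) : G ⧸ K.toSubgroup) :=
      conj K (θ g) n (hn' K)
    have h2 : ev K ((θ g : G) : G ⧸ K.toSubgroup) = ((g * n : G) : G ⧸ K.toSubgroup) := by
      have := ev_smul K g ((1 : G) : G ⧸ K.toSubgroup)
      rw [MulAction.Quotient.smul_coe, smul_eq_mul, mul_one, hn' K,
        MulAction.Quotient.smul_coe, smul_eq_mul] at this
      exact this
    rw [h1] at h2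
    -- `n θ(g) ≡ g n (mod K)`, i.e. `(n⁻¹ g n)⁻¹ θ(g) ∈ K`
    have h3 : (n * θ g)⁻¹ * (g * n) ∈ K.toSubgroup := QuotientGroup.eq.mp h2
    have h4 : (n⁻¹ * g * n)⁻¹ * θ g = ((n * θ g)⁻¹ * (g * n))⁻¹ := by group
    rw [h4]
    exact K.toSubgroup.inv_mem h3
  by_contra hne
  have hne' : (n⁻¹ * g * n)⁻¹ * θ g ≠ 1 := by
    intro h
    apply hne
    rw [inv_mul_eq_one] at h
    exact h.symm
  obtain ⟨K₁, hK₁⟩ := ProfiniteGrp.exist_openNormalSubgroup_sub_open_nhds_of_one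
    (isOpen_compl_singleton (x := (n⁻¹ * g * n)⁻¹ * θ g))
    (show (1 : G) ∈ ({(n⁻¹ * g * n)⁻¹ * θ g}ᶜ : Set G) from fun h => hne' h.symm)
  exact hK₁ (hmem K₁) rfl

/-- **Untwisted case**: an endomorphism family of the identity functor of `P` (natural maps
`η_U : U → U` commuting with the action) is, on the coset objects, right translation by a CENTRAL
element. [cite: MochizukiSemiAnbd2006, Section 0 p.6] -/
theorem exists_mem_center_of_natural_family (P : ObjectProperty (BCat G))
    (hP : ∀ (K : OpenNormalSubgroup G) [Finite (G ⧸ K.toSubgroup)],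
      P (Induction.quotObj K.toSubgroup K.isOpen'))
    (η : ∀ U : P.FullSubcategory, U.obj.obj.V → U.obj.obj.V)
    (hηeq : ∀ (U : P.FullSubcategory) (g : G) (x : U.obj.obj.V), η U (g • x) = g • η U x)
    (hηnat : ∀ {U V : P.FullSubcategory} (k : U ⟶ V) (x : U.obj.obj.V),
      η V (k.hom.hom.hom x) = k.hom.hom.hom (η U x)) :
    ∃ n : G, n ∈ Subgroup.center G ∧ ∀ g : G, g = n⁻¹ * g * n := by
  obtain ⟨n, hn⟩ := exists_eq_conj_of_twisted_natural (MonoidHom.id G) P hP η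
    (fun U g x => hηeq U g x) hηnat
  refine ⟨n, Subgroup.mem_center_iff.mpr fun g => ?_, fun g => hn g⟩
  have h := hn g
  rw [MonoidHom.id_apply] at h
  -- `g = n⁻¹ g n` ⇒ `n g = g n`
  calc g * n = n * (n⁻¹ * g * n) := by group
    _ = n * g := by rw [← h]

end Literature.AnabelianGeometry.Anabelioids
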